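import Literature.AnabelianGeometry.EtaleTheta.Thm16SubdagCompanion
import Literature.AnabelianGeometry.EtaleTheta.Discharge.Sec1Thm16GKN
import Literature.AnabelianGeometry.EtaleTheta.Discharge.Sec1Thm16GKNTate
import Literature.AnabelianGeometry.EtaleTheta.Discharge.Sec1OrbitGenerator
import HarnessLib

/-!
# [EtTh] §1: the ORIGIN CLAUSES of the §1 setting as ONE predicate (`ThetaSetting.IsThm16Origin`,
# `MuTwoSetting.IsDef17Origin`) and the binders of the cell they discharge
# (abc-iut-L2-lead ROW «§1 ORIGIN CLAUSES, ONE PREDICATE», 2026-08-26T03:20:26Z)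

S. Mochizuki, *The étale theta function and its Frobenioid-theoretic manifestations*, Publ. RIMS **45**
(2009), §1: the setting pp. 12–13 (printed 238–239: «the universal graph-covering of the dual graph of
this special fiber determines […] a natural surjection `Π^tp_X ↠ Z` whose kernel […] `Π^tp_Y`»; the
construction of `Y_N` from «any decomposition group of a cusp of `Y^log`»; «`(Δ^tp_Y)^ell [≅ Ẑ(1)]`,
`1 → (Δ^tp_Y)^ell ⊗ ℤ/Nℤ → Gal(Y_N/Y) → Gal(K_N/K) → 1`»; «we shall write `Π^tp_X ↠ (Π^tp_X)^Θ ↠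
(Π^tp_X)^ell` for the quotients»), Thm. 1.6 p. 24 (printed 250), Def. 1.7 p. 27 (printed 253: «`ε_μ` …
the unique nontrivial element of `Gal(Ẍ/X)` that acts trivially on the set of irreducible components of
the special fiber»), with [SemiAnbd] Thm. 3.7 (iv) for the compact (verticial) subgroups
[cite: MochizukiEtTh2009, §1 p.12]. Layer L2 of the abc-iut cell, seat abc-iut-L2-t6 (gen 4).

WHY. The root interface `ThetaSetting` (abc-iut-L2-t1) records `toZ`, `GtpYN`, `GtpTheta` as DATA with
the printed EXACT-SEQUENCE properties; the printed CHARACTERISATIONS of these data (how `Z`, `Y_N`, the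
topology of `(Π^tp_X)^Θ`, the `G_K`-module `(Δ^tp_X)^ell`, and `ε_μ` are DEFINED) are not fields and
cannot be added under the definitions freeze. The statements-first sub-DAGs K3 (Thm. 1.6,
abc-iut-L6-d5, `plan/L2/SUBDAG-EtTh-Thm16.md` v1.5, residual debts R1–R5) and K2 (Thm. 1.10,
abc-iut-w5-d140) therefore carry them as NAMED BINDERS. This file packages those binders that are
statements about `D : ThetaSetting p` ALONE into one `Prop`-valued predicate — to be INHABITED later at
abc-iut-L2-t1's root model `ThetaSetting.model p` — and proves, BY NAME, the cell's binders from it: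
* `ThetaSetting.IsThm16Origin D` — clauses R1 (`Thm16Sub.KerToZIsCompactlyGenerated`, p. 12 +
  [SemiAnbd] 3.7 (iv)), R2 (`Thm16Sub.GtpYNFromCusp D N` for every `N`, p. 13), the existence of a
  cuspidal decomposition group inside `Π^tp_Y` (`X^log` of type `(1,1)`, p. 12), R3 (`(Π^tp_X)^Θ`,
  `(Π^tp_X)^ell` carry the quotient topology, p. 12), and (TM₂) the TATE-MODULE CLAUSE at level `2`
  drafted by abc-iut-w5-d051 (`(Δ^tp_Y)^ell/2` cyclic, Tate twist, extension class = Kummer class of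
  `q_X`; p. 13, p. 16) — the only level Thm. 1.6 (i) consumes; the print-faithful clause for EVERY `N` is
  the separate predicate `ThetaSetting.IsTateOrigin` (genuine models only);
* `MuTwoSetting.IsDef17Origin M` — the same for the Def. 1.7 setting PLUS (P-C8) «`ε_μ` acts trivially
  on the set of irreducible components of the special fibre of `Ẍ`», typed as
  `M.epsMu ∈ (M.GtpXdd ⊔ M.GtpY).map M.inclX` (abc-iut-L2-d1's necessary-and-sufficient form);
* consequences, ONE origin hypothesis each: `IsThm16Origin.gknIsKernelOfAction_two` (L04 at `N = 2`,
  abc-iut-w5-d051's `gknIsKernelOfAction_of_tate`; `IsTateOrigin.gknIsKernelOfAction` for every `N`), `IsThm16Origin.map_GtpY_eq` (L02),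
  **`thm16i_of_isThm16Origin`** ([EtTh] Thm. 1.6 (i) from the two origin predicates + [AbsAnab] Lem. 1.3.8
  `hΔ` + [SemiAnbd] Thm. 6.5 (iii) `h65`, through abc-iut-w5-d051's `thm16i_of_isKernelOfAction`),
  `IsThm16Origin.thetaCompanion` (R3 ⇒ t1's `ThetaCompanion γ`, abc-iut-L6-d5's
  `thetaCompanion_of_isQuotientMap`), `IsDef17Origin.even_toZ_of_lift` / `.odd_toZ_of_isAdmissibleEpsZ` /
  **`IsDef17Origin.exists_orbit_generator`** (K2 binder (B2), this seat's p419021); the K2 junction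
  `MuTwoSetting.thm110iUnique_of_referenceClass_of_prop15ii` (p420097) then takes its parity binder from
  `IsDef17Origin.odd_toZ_of_isAdmissibleEpsZ` (one line at the call site).
NOT clauses over `D` (recorded, not packaged): R4 (functorial LCFT / `Prop15ii` — a statement about the
Kummer DATA `E`, stays the named fact per `E`), R5 (cusp evaluation via the canonical integral
structure — no L2 carrier). No claim is made that the clauses hold for an abstract `D`; they are the
printed definitions, to be inhabited at GENUINE models of the §1 setting (a curve of type `(1,1)` HAS a
cusp: `exists_cuspidal_le_GtpY` is not expected at the cell's cusp-free toy non-vacuity model, where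
`gtpYN_fromCusp` is vacuously true and (TM₂) holds — abc-iut-w5-d051). HONEST FRAMING: typed ≠ proved for [EtTh]; nothing
here bears on the disputed [IUTchIII] Cor. 3.12.
-/

noncomputable section

namespace Literature.AnabelianGeometry.EtaleTheta

open Literature.AnabelianGeometry.SemiGraphs Topology

variable {p : ℕ} [Fact p.Prime]

/-! ### The predicate for the §1 setting -/

/-- **The origin clauses of the §1 setting** (`ThetaSetting`, pp. 12–13): the printed CHARACTERISATIONS
of the data `toZ` (R1), `GtpYN` (R2, + a cusp of `X^log` inside `Π^tp_Y`), the topology of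
`(Π^tp_X)^Θ ↠ (Π^tp_X)^ell` (R3), and the `G_K`-module structure of `(Δ^tp_X)^ell` modulo every `N`
(TM: cyclic `(Δ^tp_Y)^ell/N ≅ ℤ/Nℤ(1)`, Tate twist, extension class = Kummer class of `q_X`; clause text by
abc-iut-w5-d051). A `Prop`-valued predicate on `D`; to be inhabited at the root model, never asserted.
[cite: MochizukiEtTh2009, §1 p.12] -/
structure ThetaSetting.IsThm16Origin (D : ThetaSetting p) : Prop where
  /-- R1 (p. 12; [SemiAnbd] Thm. 3.7 (iv)): `Π^tp_Y = Ker(Π^tp_X ↠ Z)` is the closed subgroup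
  topologically generated by the compact subgroups of `Π^tp_X` (the dual graph of the special fibre of
  `X` is one vertex with one loop; `Z` is discrete torsion-free). -/
  kerToZ_compactlyGenerated : Thm16Sub.KerToZIsCompactlyGenerated D
  /-- R2 (p. 13): for every `N`, `Π^tp_{Y_N}` IS the printed subgroup cut out by a cusp section and
  `N·(Δ^tp_Y)^ell` (abc-iut-L6-d5's `GtpYNFromCusp`). -/
  gtpYN_fromCusp : ∀ N : ℕ+, Thm16Sub.GtpYNFromCusp D N
  /-- `X^log` is of type `(1,1)` (p. 12): it HAS a cusp, and a decomposition group of it lies in `Π^tp_Y`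
  (cusps map to the vertex of the dual graph). -/
  exists_cuspidal_le_GtpY :
    ∃ Dc : Subgroup D.PiTemp, D.IsCuspidalDecompositionGroup Dc ∧ Dc ≤ D.GtpY
  /-- R3 (p. 12 «the quotients `Π^tp_X ↠ (Π^tp_X)^Θ`»): `(Π^tp_X)^Θ` carries the quotient topology. -/
  isQuotientMap_toTheta : IsQuotientMap D.toTheta
  /-- R3, second quotient: `(Π^tp_X)^Θ ↠ (Π^tp_X)^ell` is a quotient map. -/
  isQuotientMap_thetaToEll : IsQuotientMap D.thetaToEll
  /-- (TM₂) Tate-module clause AT LEVEL `N = 2` — the only level Thm. 1.6 (i) consumes (clause text by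
  abc-iut-w5-d051, its `N := 2` instance): there are `y₁ ∈ Δ^tp_Y`, `z ∈ Δ^tp_X` lifting `1 ∈ Z`, a
  primitive square root of unity `ζ = −1` and a square root `r` of `q_X` with (a) `(Δ^tp_Y)^ell/2` cyclic
  of order `2` generated by `y₁`, (b) `G_K` acting on all of `(Δ^tp_Y)^ell/2` through the mod-`2`
  cyclotomic character («`(Δ^tp_Y)^ell ≅ Ẑ(1)`», p. 13), (c) the commutator of `z` with `g` equal to the
  Kummer cocycle of `r` («`G_{K_N}` acts trivially on `(Δ^tp_X)^ell/N·(Δ^tp_Y)^ell`», `K_2 = K(q_X^{1/2})`,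
  p. 13). The print-faithful clause FOR EVERY `N` is the separate predicate `IsTateOrigin` below (genuine
  models only: at the cell's toy non-vacuity model, with split `Π^tp`, it fails for `N ≥ 3` —
  abc-iut-w5-d051, INBOX 2026-08-26T04:10:07Z). -/
  tate2 : ∃ (y₁ z : D.PiTemp) (ζ r : PadicAlgCl p),
    y₁ ∈ D.DtpY ∧ z ∈ D.DeltaTemp ∧ D.toZ z = Multiplicative.ofAdd 1 ∧
    IsPrimitiveRoot ζ ((2 : ℕ+) : ℕ) ∧ r ^ ((2 : ℕ+) : ℕ) = D.qX ∧
    (∀ y ∈ D.DtpY, ∃ k : ℕ,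
      Thm16Sub.toEll D y * (Thm16Sub.toEll D y₁ ^ k)⁻¹ ∈ Thm16Sub.ellPowersY D 2) ∧
    (∀ k : ℕ, Thm16Sub.toEll D y₁ ^ k ∈ Thm16Sub.ellPowersY D 2 ↔ ((2 : ℕ+) : ℕ) ∣ k) ∧
    (∀ (g : D.PiTemp) (k : ℕ), D.aug g ζ = ζ ^ k → ∀ y ∈ D.DtpY,
      Thm16Sub.toEll D (g * y * g⁻¹) * (Thm16Sub.toEll D y ^ k)⁻¹ ∈ Thm16Sub.ellPowersY D 2) ∧
    (∀ (g : D.PiTemp) (m : ℕ), D.aug g r = ζ ^ m * r →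
      Thm16Sub.toEll D (g * z * g⁻¹ * z⁻¹) * (Thm16Sub.toEll D y₁ ^ m)⁻¹ ∈ Thm16Sub.ellPowersY D 2)

/-- **The print-faithful Tate-module clause for EVERY level `N`** (abc-iut-w5-d051's text, verbatim):
«`(Δ^tp_Y)^ell ≅ Ẑ(1)`», «`1 → (Δ^tp_Y)^ell ⊗ ℤ/Nℤ → Gal(Y_N/Y) → Gal(K_N/K) → 1`», «`G_{K_N}` acts
trivially on `(Δ^tp_X)^ell/N·(Δ^tp_Y)^ell`» (p. 13), «`Δ^tp_Y/Δ^tp_{Y_N} ≅ ℤ/Nℤ(1)`» (p. 16), in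
mod-`N` form. Kept SEPARATE from `IsThm16Origin`: it is meant for GENUINE models of the §1 setting only
(it fails for `N ≥ 3` at the cell's toy non-vacuity model with split `Π^tp_X = F₂ × G_{ℚ_p}`); never
asserted. [cite: MochizukiEtTh2009, §1 p.13] -/
structure ThetaSetting.IsTateOrigin (D : ThetaSetting p) : Prop where
  /-- (TM) for every `N ≥ 1`: generator `y₁`, lift `z` of `1 ∈ Z`, primitive `ζ_N`, `r = q_X^{1/N}` with
  (a) cyclicity of order `N`, (b) Tate twist, (c) Kummer class of `q_X`. -/
  tate : ∀ N : ℕ+, ∃ (y₁ z : D.PiTemp) (ζ r : PadicAlgCl p),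
    y₁ ∈ D.DtpY ∧ z ∈ D.DeltaTemp ∧ D.toZ z = Multiplicative.ofAdd 1 ∧
    IsPrimitiveRoot ζ (N : ℕ) ∧ r ^ (N : ℕ) = D.qX ∧
    (∀ y ∈ D.DtpY, ∃ k : ℕ,
      Thm16Sub.toEll D y * (Thm16Sub.toEll D y₁ ^ k)⁻¹ ∈ Thm16Sub.ellPowersY D N) ∧
    (∀ k : ℕ, Thm16Sub.toEll D y₁ ^ k ∈ Thm16Sub.ellPowersY D N ↔ (N : ℕ) ∣ k) ∧
    (∀ (g : D.PiTemp) (k : ℕ), D.aug g ζ = ζ ^ k → ∀ y ∈ D.DtpY,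
      Thm16Sub.toEll D (g * y * g⁻¹) * (Thm16Sub.toEll D y ^ k)⁻¹ ∈ Thm16Sub.ellPowersY D N) ∧
    (∀ (g : D.PiTemp) (m : ℕ), D.aug g r = ζ ^ m * r →
      Thm16Sub.toEll D (g * z * g⁻¹ * z⁻¹) * (Thm16Sub.toEll D y₁ ^ m)⁻¹ ∈ Thm16Sub.ellPowersY D N)

/-- **The origin clauses of the Def. 1.7 setting** (`MuTwoSetting`, p. 27): those of the underlying §1
setting PLUS the printed characterisation of `ε_μ` — «the unique nontrivial element of `Gal(Ẍ/X)` that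
acts trivially on the set of irreducible components of the special fiber», i.e. (the special fibre of `Ẍ`
having two components, swapped exactly by the elements of odd `toZ`) `ε_μ ∈ Π^tp_Ẍ · Π^tp_Y`
(abc-iut-L2-d1's form; necessary and sufficient for the cyclicity of `Π^tp_Ẋ/Π^tp_Ÿ`, census item P-C8
of abc-iut-L2-d3). A predicate on `M`; to be inhabited at the model, never asserted.
[cite: MochizukiEtTh2009, Def 1.7 p.27] -/
structure MuTwoSetting.IsDef17Origin (M : MuTwoSetting p) : Prop
    extends ThetaSetting.IsThm16Origin M.toThetaSetting where
  /-- (P-C8) `ε_μ` acts trivially on the set of irreducible components of the special fibre of `Ẍ`: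
  `ε_μ ∈ Π^tp_Ẍ · Π^tp_Y` (equivalently, `toZ` of any lift of `ε_μ` is even). -/
  epsMu_mem_sup : M.epsMu ∈ (M.GtpXdd ⊔ M.GtpY).map M.inclX

/-! ### Consequences for the §1 setting (K3 binders) -/

namespace ThetaSetting.IsThm16Origin

variable {D Dα Dβ : ThetaSetting p}

/-- **L04 at level `2`** («`G_{K_2}` acts trivially on `(Δ^tp_X)^ell/2·(Δ^tp_Y)^ell`» as the
CHARACTERISATION of `G_{K_2} = G_K̈`, abc-iut-L6-d5's `GKNIsKernelOfAction D 2`): from the clause (TM₂),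
through abc-iut-w5-d051's per-level `gknIsKernelOfAction_of_tate` (p420414). Replaces GAP row
G-w5d051-1's binder. [cite: MochizukiEtTh2009, §1 p.13] -/
theorem gknIsKernelOfAction_two (h : D.IsThm16Origin) : Thm16Sub.GKNIsKernelOfAction D 2 := by
  obtain ⟨y₁, z, ζ, r, hy₁, hz, hzZ, hζ, hr, -, hord, htw, hkum⟩ := h.tate2
  exact Thm16Sub.gknIsKernelOfAction_of_tate D 2 hy₁ hz hzZ hζ hr hord htw hkum

/-- **L02**: for origin settings on both sides EVERY isomorphism of topological groups
`γ : Π^tp_{Xα} ⥲ Π^tp_{Xβ}` carries `Π^tp_{Yα}` onto `Π^tp_{Yβ}` («immediate from the definitions; the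
discreteness of `Z`», p. 24; abc-iut-L6-d5's `map_GtpY_eq_of_kerToZ`). [cite: MochizukiEtTh2009, Thm 1.6 (i) p.24] -/
theorem map_GtpY_eq (hα : Dα.IsThm16Origin) (hβ : Dβ.IsThm16Origin) (γ : Dα.PiTemp ≃ₜ* Dβ.PiTemp) :
    Dα.GtpY.map γ.toMulEquiv.toMonoidHom = Dβ.GtpY :=
  Thm16Sub.map_GtpY_eq_of_kerToZ γ hα.kerToZ_compactlyGenerated hβ.kerToZ_compactlyGenerated

/-- **[EtTh] Thm. 1.6 (i) from the origin predicates**: for origin settings `α`, `β` and an isomorphism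
`γ : Π^tp_{Xα} ⥲ Π^tp_{Xβ}` preserving `Δ^tp_X` (`hΔ`, [AbsAnab] Lem. 1.3.8 — layer L4) and cuspidal
decomposition groups (`h65`, [SemiAnbd] Thm. 6.5 (iii) — layer L3), t1's `Thm16i γ` holds: `γ` carries
`Π^tp_{Ÿα}` onto `Π^tp_{Ÿβ}`. Composition of abc-iut-w5-d051's `thm16i_of_isKernelOfAction` (K3 leaves
L02, L04, L05) with the clauses R1, R2, TM and the cusp of `X^log`. [cite: MochizukiEtTh2009, Thm 1.6 (i) p.24] -/
theorem thm16i (hα : Dα.IsThm16Origin) (hβ : Dβ.IsThm16Origin) (γ : Dα.PiTemp ≃ₜ* Dβ.PiTemp)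
    (hΔ : Dα.DeltaTemp.map γ.toMulEquiv.toMonoidHom = Dβ.DeltaTemp)
    (h65 : Dα.IsoPreservesCuspidalDecomp Dβ.toTemperedCurve) : ThetaSetting.Thm16i γ :=
  Thm16Sub.thm16i_of_isKernelOfAction γ hΔ hα.kerToZ_compactlyGenerated hβ.kerToZ_compactlyGenerated
    hα.gknIsKernelOfAction_two hβ.gknIsKernelOfAction_two (hα.gtpYN_fromCusp 2) (hβ.gtpYN_fromCusp 2)
    h65 hα.exists_cuspidal_le_GtpY

/-- **R3 ⇒ t1's `ThetaCompanion γ`** (Thm. 1.6 (ii) «induces an isomorphism of topological groups»): for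
origin settings the companion `(Π^tp_{Xα})^Θ ⥲ (Π^tp_{Xβ})^Θ` of a `Δ^tp_X`-preserving `γ` is a
homeomorphism (abc-iut-L6-d5's `thetaCompanion_of_isQuotientMap`). [cite: MochizukiEtTh2009, Thm 1.6 (ii) p.24] -/
def thetaCompanion (hα : Dα.IsThm16Origin) (hβ : Dβ.IsThm16Origin) (γ : Dα.PiTemp ≃ₜ* Dβ.PiTemp)
    (hΔ : Dα.DeltaTemp.map γ.toMulEquiv.toMonoidHom = Dβ.DeltaTemp) : ThetaSetting.ThetaCompanion γ :=
  Thm16Sub.thetaCompanion_of_isQuotientMap Dα Dβ γ hΔ hα.isQuotientMap_toTheta hβ.isQuotientMap_toTheta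

end ThetaSetting.IsThm16Origin

/-- **L04 for EVERY `N` at a genuine origin** (`IsTateOrigin`): abc-iut-w5-d051's
`gknIsKernelOfAction_of_tateClause`. [cite: MochizukiEtTh2009, §1 p.13] -/
theorem ThetaSetting.IsTateOrigin.gknIsKernelOfAction {D : ThetaSetting p} (h : D.IsTateOrigin)
    (N : ℕ+) : Thm16Sub.GKNIsKernelOfAction D N :=
  Thm16Sub.gknIsKernelOfAction_of_tateClause D h.tate N

/-- A genuine origin's level-`2` clause: `IsTateOrigin` supplies the (TM₂) field of `IsThm16Origin`.
[cite: MochizukiEtTh2009, §1 p.13] -/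
theorem ThetaSetting.IsTateOrigin.tate2 {D : ThetaSetting p} (h : D.IsTateOrigin) :
    ∃ (y₁ z : D.PiTemp) (ζ r : PadicAlgCl p),
      y₁ ∈ D.DtpY ∧ z ∈ D.DeltaTemp ∧ D.toZ z = Multiplicative.ofAdd 1 ∧
      IsPrimitiveRoot ζ ((2 : ℕ+) : ℕ) ∧ r ^ ((2 : ℕ+) : ℕ) = D.qX ∧
      (∀ y ∈ D.DtpY, ∃ k : ℕ,
        Thm16Sub.toEll D y * (Thm16Sub.toEll D y₁ ^ k)⁻¹ ∈ Thm16Sub.ellPowersY D 2) ∧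
      (∀ k : ℕ, Thm16Sub.toEll D y₁ ^ k ∈ Thm16Sub.ellPowersY D 2 ↔ ((2 : ℕ+) : ℕ) ∣ k) ∧
      (∀ (g : D.PiTemp) (k : ℕ), D.aug g ζ = ζ ^ k → ∀ y ∈ D.DtpY,
        Thm16Sub.toEll D (g * y * g⁻¹) * (Thm16Sub.toEll D y ^ k)⁻¹ ∈ Thm16Sub.ellPowersY D 2) ∧
      (∀ (g : D.PiTemp) (m : ℕ), D.aug g r = ζ ^ m * r →
        Thm16Sub.toEll D (g * z * g⁻¹ * z⁻¹) * (Thm16Sub.toEll D y₁ ^ m)⁻¹ ∈ Thm16Sub.ellPowersY D 2) :=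
  h.tate 2

/-- Alias under the name the row announced: Thm. 1.6 (i) from the origin predicates.
[cite: MochizukiEtTh2009, Thm 1.6 (i) p.24] -/
theorem thm16i_of_isThm16Origin {Dα Dβ : ThetaSetting p} (hα : Dα.IsThm16Origin)
    (hβ : Dβ.IsThm16Origin) (γ : Dα.PiTemp ≃ₜ* Dβ.PiTemp)
    (hΔ : Dα.DeltaTemp.map γ.toMulEquiv.toMonoidHom = Dβ.DeltaTemp)
    (h65 : Dα.IsoPreservesCuspidalDecomp Dβ.toTemperedCurve) : ThetaSetting.Thm16i γ :=
  hα.thm16i hβ γ hΔ h65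

/-! ### Consequences for the Def. 1.7 setting (K2 binder (B2), parity of `ε_Z`) -/

namespace MuTwoSetting.IsDef17Origin

variable {M : MuTwoSetting p}

/-- (P-C8) ⇒ **`toZ` of every lift of `ε_μ` is EVEN** (`Π^tp_Ẍ ⊆ toZ⁻¹(2ℤ)`, `Π^tp_Y = toZ⁻¹(0)`).
[cite: MochizukiEtTh2009, Def 1.7 p.27] -/
theorem even_toZ_of_lift (h : M.IsDef17Origin) {μ : M.PiTemp} (hμX : M.inclX μ = M.epsMu) :
    Even (Multiplicative.toAdd (M.toZ μ)) := by
  have hmem : μ ∈ M.GtpXdd ⊔ M.GtpY := by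
    have h1 : M.inclX μ ∈ (M.GtpXdd ⊔ M.GtpY).map M.inclX := hμX ▸ h.epsMu_mem_sup
    exact (Subgroup.mem_map_iff_mem M.injective_inclX).mp h1
  have hle : M.GtpXdd ⊔ M.GtpY ≤ (AddSubgroup.zmultiples (2 : ℤ)).toSubgroup.comap M.toZ := by
    refine sup_le M.GtpXdd_le_comap_toZ_two fun g hg => ?_
    have hg' : M.toZ g = 1 := by
      change g ∈ M.toZ.ker at hg
      exact (MonoidHom.mem_ker).mp hg
    simp only [Subgroup.mem_comap, Multiplicative.mem_toSubgroup, hg', toAdd_one]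
    exact zero_mem _
  have hμ2 := hle hmem
  simp only [Subgroup.mem_comap, Multiplicative.mem_toSubgroup, Int.mem_zmultiples_iff] at hμ2
  obtain ⟨k, hk⟩ := hμ2
  exact ⟨k, by rw [hk]; ring⟩

/-- (P-C8) ⇒ **every lift of an ADMISSIBLE `ε_Z` has ODD `toZ`** (this seat's
`odd_toZ_of_isAdmissibleEpsZ`, p419021). [cite: MochizukiEtTh2009, Def 1.7 p.27] -/
theorem odd_toZ_of_isAdmissibleEpsZ (h : M.IsDef17Origin) {εZ : M.GtpC} (hZ : M.IsAdmissibleEpsZ εZ)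
    {σZ : M.PiTemp} (hσZ : M.inclX σZ = εZ) : Odd (Multiplicative.toAdd (M.toZ σZ)) := by
  obtain ⟨μ, hμX⟩ := M.epsMu_mem
  exact M.odd_toZ_of_isAdmissibleEpsZ hZ hσZ hμX (h.even_toZ_of_lift hμX)

/-- **The K2 binder (B2) from the origin predicate**: for an admissible `ε_Z`, `Π^tp_Ẋ/Π^tp_Ÿ ≅ ℤ` has a
generator `σ₁` (`toZ σ₁ = 1`; every `σ` with `inclX σ ∈ Π^tp_Ẋ` is `σ₁^a·h`, `h ∈ Π^tp_Ÿ`) — GAP row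
G-L2t6g4-3 CLOSED modulo `IsDef17Origin`. [cite: MochizukiEtTh2009, Def 1.9 p.29] -/
theorem exists_orbit_generator (h : M.IsDef17Origin) {εZ : M.GtpC} (hZ : M.IsAdmissibleEpsZ εZ) :
    ∃ σ₁ : M.PiTemp, M.inclX σ₁ ∈ M.dotX εZ ∧ Multiplicative.toAdd (M.toZ σ₁) = 1 ∧
      ∀ σ : M.PiTemp, M.inclX σ ∈ M.dotX εZ →
        ∃ (a : ℤ) (h : M.PiTemp), h ∈ M.toThetaSetting.GtpYdd ∧ σ = σ₁ ^ a * h := by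
  obtain ⟨σZ, hσZ⟩ := hZ.1
  exact MuTwoSetting.exists_orbit_generator hσZ (h.odd_toZ_of_isAdmissibleEpsZ hZ hσZ)

end MuTwoSetting.IsDef17Origin

end Literature.AnabelianGeometry.EtaleTheta

end
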